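import Summits.ValiantsHypothesis.ValiantsHypothesis.Theorems.VPBoundarySquareWsSandwich
import Literature.Computability.AlgebraicComplexity.BLMW11FormulasWeaklySkew
import Literature.Computability.AlgebraicComplexity.BLMW11WeaklySkewToSkewProofs
import HarnessLib

/-!
# The border-FORMULA notch of the ws-border sandwich (decomp-valiant workshop, lens 3 g24)

Census cell **V25** of the border / debordering axis, kernel-checked.  Write, in the tree's
Zariski rendering of approximate complexity (BLMW 2011, Def. 9.3.1: `approxWsComplexity`,
`IsVPwsBarFamily`),

* `A := PerNotInVPwsBar`   — `(per_n) ∉ \overline{VP_ws}`   (route `WsBorderSandwich`, item 23469),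
* `B := VPSubsetVPwsBar`   — `VP ⊆ \overline{VP_ws}`        (item 23468),
* `H` — `(per_n) ∉ \overline{VP_e}`: the border FORMULA complexity of the permanent is not
  p-bounded (`¬ IsPBounded fun n => approxOf formulaComplexity (perPoly (Fin n) ℂ)`),
* `D` — `(det_n) ∈ \overline{VP_e}`: the determinant has p-bounded border formula complexity
  (`IsPBounded fun n => approxOf formulaComplexity (detPoly (Fin n) ℂ)`), i.e. `VP_ws ⊆ \overline{VP_e}`;
  its negation `VP_s ⊄ \overline{VP_e}` is the separation Bringmann–Ikenmeyer–Zuiddam single out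
  as "natural to try to prove … instead of the slightly weaker `VP_e ⊊ VP_s`" (J. ACM 65 (2018)
  32, p. 32:2–32:3), and `\overline{VP_e} = \overline{VP_2}` (ibid. Thm. 3.1/Cor. 3.9, char ≠ 2),
* `T' := VP ⊆ \overline{VP_e}`.

This file proves the plumbing of the notch one class below the ws-border sandwich:

* `§1` a generic **closure-operator transport** for size measures `μ ν : ℂ[x_σ] → ℕ` and the
  border measure `approxOf μ f := min {r | coeffVec f ∈ Zcl(coeffVec '' {μ ≤ r})}`:
  monotonicity in the measure (`approxOf_mono`) and the transport of a UNIFORM bound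
  `approxOf ν ≤ q ∘ μ` through the closure, `approxOf ν ≤ q ∘ approxOf μ`
  (`approxOf_le_of_uniform` — closure is monotone and idempotent);
* `§2` projections do not increase border formula complexity (`approxFormula_le_of_isProjection`);
* `§3` the three typings of `D` are equivalent (`detD_iff_uniformD`, `familyD_iff_detD`):
  single family `(det_n) ∈ \overline{VP_e}` ⟺ uniform translation
  `∃ a c, ∀ g, approxOf formulaComplexity g ≤ a · (L_ws(g) + 1) ^ c` ⟺ class inclusion
  `VP_ws ⊆ \overline{VP_e}` — by the tree's `VP_ws`-universality of `det` with linear size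
  (`HI16Skew.isProjection_detPoly_of_isSkew`, `BLMW2011_sec9_detVPws_holds` (iii));
* `§4` the notch identities: `A → H` (`perNotInVFBar_of_perNotInVPwsBar`), `H → D → A`
  (`perNotInVPwsBar_of_formulaNotch`), hence `H → D → B → VP ≠ VNP`
  (`valiant_of_formulaNotch`, through the lineage kernel `valiant_of_sandwich`); under `D` the two
  border classes coincide on every family (`vfBar_iff_vpwsBar`); `T' → B`, `T' → D`,
  `B → D → T'` (`vpSubsetVFBar_iff`).

Reading (workshop doctrine): the VF notch is a ROTATION of the ws notch — the residual descends
from `A` to the weaker `H` exactly at the price of the new UNDECIDED piece `D` (no tag moves on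
`S`'s pieces); it is recorded, not filed.  No new `Prop` constants; one generic `ℕ`-valued
measure `approxOf`. 0 sorry.
-/

set_option linter.dupNamespace false

namespace Summit.ValiantsHypothesis.ValiantsHypothesis.Theorems.BorderFormulaNotch

open MvPolynomial
open Literature.Computability.AlgebraicComplexity
open Summit.ValiantsHypothesis.ValiantsHypothesis.Theses.WsBorderSandwich (VPSubsetVPwsBar PerNotInVPwsBar)
open Summit.ValiantsHypothesis.ValiantsHypothesis.Theorems.VPBoundarySquareWsSandwich (valiant_of_sandwich)

/-! ## §1 The closure operator attached to a size measure -/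

section Approx

variable {σ : Type*}

/-- The border (approximate) complexity attached to a size measure `μ` on `ℂ[x_σ]`: the least `r`
such that `f` lies in the Zariski closure (coefficient space) of `{g | μ g ≤ r}` — BLMW 2011,
Def. 9.3.1 with `L` replaced by an arbitrary measure (`approxWsComplexity = approxOf L_ws`,
`approxOf_wsComplexity`).  `sInf` junk `0` on an empty set does not occur (`r = μ f` qualifies).
[cite: BurgisserEtAl2011, Def. 9.3.1] -/
noncomputable def approxOf (μ : MvPolynomial σ ℂ → ℕ) (f : MvPolynomial σ ℂ) : ℕ :=
  sInf {r | coeffVec f ∈ zariskiClosure (coeffVec '' {g : MvPolynomial σ ℂ | μ g ≤ r})}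

/-- `approxOf L_ws` is the tree's `\underline{L_ws}` (BLMW 2011, Def. 9.3.1). [cite: BurgisserEtAl2011, Def. 9.3.1] -/
theorem approxOf_wsComplexity [Fintype σ] [DecidableEq σ] (f : MvPolynomial σ ℂ) :
    approxOf (fun g => wsComplexity g) f = approxWsComplexity f := rfl

variable (μ : MvPolynomial σ ℂ → ℕ)

/-- `μ f ≤ r` puts `f` in the closure of `{μ ≤ r}` (it is in the set). [cite: BurgisserEtAl2011, Def. 9.3.1] -/
theorem coeffVec_mem_closure_of_le {f : MvPolynomial σ ℂ} {r : ℕ} (h : μ f ≤ r) :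
    coeffVec f ∈ zariskiClosure (coeffVec '' {g : MvPolynomial σ ℂ | μ g ≤ r}) :=
  subset_zariskiClosure _ ⟨f, h, rfl⟩

/-- Intro lemma for `approxOf μ f ≤ r`. [cite: BurgisserEtAl2011, Def. 9.3.1] -/
theorem approxOf_le_of_mem {f : MvPolynomial σ ℂ} {r : ℕ}
    (h : coeffVec f ∈ zariskiClosure (coeffVec '' {g : MvPolynomial σ ℂ | μ g ≤ r})) :
    approxOf μ f ≤ r := by
  unfold approxOf
  exact Nat.sInf_le h

/-- `approxOf μ f ≤ μ f` (exact computation bounds border computation). [cite: BurgisserEtAl2011, §9.3] -/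
theorem approxOf_le_self (f : MvPolynomial σ ℂ) : approxOf μ f ≤ μ f :=
  approxOf_le_of_mem μ (coeffVec_mem_closure_of_le μ le_rfl)

/-- The closed sublevel sets grow with the level. [cite: BurgisserEtAl2011, Def. 9.3.1] -/
theorem closure_sublevel_mono {r s : ℕ} (h : r ≤ s) :
    zariskiClosure (coeffVec '' {g : MvPolynomial σ ℂ | μ g ≤ r}) ⊆
      zariskiClosure (coeffVec '' {g : MvPolynomial σ ℂ | μ g ≤ s}) :=
  zariskiClosure_mono (Set.image_mono fun _ hg => le_trans hg h)

/-- The infimum defining `approxOf μ f` is attained. [cite: BurgisserEtAl2011, Def. 9.3.1] -/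
theorem coeffVec_mem_closure_approxOf (f : MvPolynomial σ ℂ) :
    coeffVec f ∈ zariskiClosure (coeffVec '' {g : MvPolynomial σ ℂ | μ g ≤ approxOf μ f}) :=
  Nat.sInf_mem (s := {r | coeffVec f ∈ zariskiClosure
      (coeffVec '' {g : MvPolynomial σ ℂ | μ g ≤ r})}) ⟨μ f, coeffVec_mem_closure_of_le μ le_rfl⟩

/-- Elimination lemma for `approxOf μ f ≤ R`. [cite: BurgisserEtAl2011, Def. 9.3.1] -/
theorem coeffVec_mem_closure_of_approxOf_le {f : MvPolynomial σ ℂ} {R : ℕ} (h : approxOf μ f ≤ R) :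
    coeffVec f ∈ zariskiClosure (coeffVec '' {g : MvPolynomial σ ℂ | μ g ≤ R}) :=
  closure_sublevel_mono μ h (coeffVec_mem_closure_approxOf μ f)

/-- `approxOf μ f ≤ R` iff `f` lies in the closure of `{μ ≤ R}`. [cite: BurgisserEtAl2011, Def. 9.3.1] -/
theorem approxOf_le_iff {f : MvPolynomial σ ℂ} {R : ℕ} :
    approxOf μ f ≤ R ↔ coeffVec f ∈ zariskiClosure (coeffVec '' {g : MvPolynomial σ ℂ | μ g ≤ R}) :=
  ⟨coeffVec_mem_closure_of_approxOf_le μ, approxOf_le_of_mem μ⟩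

variable {μ}

/-- **Monotonicity in the measure**: `μ ≤ ν` pointwise gives `approxOf μ ≤ approxOf ν` (the
`ν`-sublevel sets sit inside the `μ`-sublevel sets).  With `μ = L_ws`, `ν = L_e` this is
`\overline{VP_e} ⊆ \overline{VP_ws}`. [cite: BurgisserEtAl2011, §9.1 (L_e ≥ L_ws ≥ L), §9.3] -/
theorem approxOf_mono {ν : MvPolynomial σ ℂ → ℕ} (h : ∀ g, μ g ≤ ν g) (f : MvPolynomial σ ℂ) :
    approxOf μ f ≤ approxOf ν f :=
  approxOf_le_of_mem μ (zariskiClosure_mono (Set.image_mono fun g hg => (h g).trans hg)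
    (coeffVec_mem_closure_approxOf ν f))

/-- **Closure-operator transport of a uniform bound.**  If the border `ν`-complexity of EVERY
polynomial is bounded by a monotone function of its exact `μ`-complexity, `approxOf ν ≤ q ∘ μ`,
then also `approxOf ν ≤ q ∘ approxOf μ`: the `μ`-sublevel set `{μ ≤ R}` lies in the Zariski-closed
set `Zcl{ν ≤ q R}`, hence so does its closure (closure is monotone and idempotent).  This is the
one-line reason why a uniform debordering / simulation statement between two exact classes
passes to their closures. [cite: BurgisserEtAl2011, §9.3 (Def. 9.3.1); MulmuleySohoni2001, §4] -/
theorem approxOf_le_of_uniform {ν : MvPolynomial σ ℂ → ℕ} {q : ℕ → ℕ} (hq : Monotone q)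
    (hD : ∀ g : MvPolynomial σ ℂ, approxOf ν g ≤ q (μ g)) (f : MvPolynomial σ ℂ) :
    approxOf ν f ≤ q (approxOf μ f) := by
  apply approxOf_le_of_mem
  have h2 : coeffVec '' {g : MvPolynomial σ ℂ | μ g ≤ approxOf μ f} ⊆
      zariskiClosure (coeffVec '' {g : MvPolynomial σ ℂ | ν g ≤ q (approxOf μ f)}) := by
    rintro _ ⟨g, hg, rfl⟩
    exact coeffVec_mem_closure_of_approxOf_le ν ((hD g).trans (hq hg))
  exact zariskiClosure_image_subset_of_subset h2 (coeffVec_mem_closure_approxOf μ f)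

end Approx

/-! ## §2 Border formula complexity: `\overline{VP_e} ⊆ \overline{VP_ws}` and projections -/

section Formula

variable {σ τ : Type*}

/-- `\underline{L_ws}(f) ≤ \underline{L_e}(f)`: pointwise `\overline{VP_e} ⊆ \overline{VP_ws}`, from
`L_ws ≤ L_e` (`wsComplexity_le_formulaComplexity`) and `approxOf_mono`.
[cite: BurgisserEtAl2011, §9.1 (L_e ≥ L_ws), §9.3] -/
theorem approxWsComplexity_le_approxFormula [Fintype σ] [DecidableEq σ] (f : MvPolynomial σ ℂ) :
    approxWsComplexity f ≤ approxOf formulaComplexity f := by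
  rw [← approxOf_wsComplexity]
  exact approxOf_mono (fun g => wsComplexity_le_formulaComplexity g) f

/-- The sublevel sets `{g | L_e(g) ≤ r}` have bounded supports (degree `≤ r + 1`, through
`deg ≤ L_ws + 1 ≤ L_e + 1`). [cite: BurgisserEtAl2011, §9.1] -/
theorem support_subset_degBox_of_formulaComplexity_le [Fintype σ] [DecidableEq σ]
    {g : MvPolynomial σ ℂ} {r : ℕ} (hg : formulaComplexity g ≤ r) :
    g.support ⊆ (Finset.range (r + 1 + 1)).biUnion
      (fun n => (Finset.univ : Finset σ).finsuppAntidiag n) :=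
  support_subset_degBox_of_wsComplexity_le ((wsComplexity_le_formulaComplexity g).trans hg)

/-- **Border formula complexity does not increase under Valiant projections** (substitute
variables / constants in the approximants: transport the closure along the linear map `aeval a`,
`coeffVec_linearMap_mem_zariskiClosure`, and use `E(aeval a g) ≤ E(g)`).
[cite: BurgisserEtAl2011, §9.1 (VP_e, projections), §9.3 (closed under p-projections)] -/
theorem approxFormula_le_of_isProjection [Fintype σ] [DecidableEq σ] {g : MvPolynomial τ ℂ}
    {f : MvPolynomial σ ℂ} (h : IsProjection g f) :
    approxOf formulaComplexity g ≤ approxOf formulaComplexity f := by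
  obtain ⟨a, ha, rfl⟩ := h
  have hf := coeffVec_mem_closure_approxOf (formulaComplexity : MvPolynomial σ ℂ → ℕ) f
  have hL := coeffVec_linearMap_mem_zariskiClosure
    (aeval a : MvPolynomial σ ℂ →ₐ[ℂ] MvPolynomial τ ℂ).toLinearMap
    (fun g hg => support_subset_degBox_of_formulaComplexity_le hg) hf
  refine approxOf_le_of_mem _ (zariskiClosure_mono ?_ hL)
  rintro _ ⟨_, ⟨g, hg, rfl⟩, rfl⟩
  refine ⟨aeval a g, ?_, rfl⟩
  exact (IsProjection.formulaComplexity_le ⟨a, ha, rfl⟩).trans hg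

end Formula

/-! ## §3 The piece `D`: three equivalent typings -/

section PieceD

/-- Monotonicity of the uniform bound shape `w ↦ a (w + 1) ^ c`. [folklore] -/
theorem monotone_mul_succ_pow (a c : ℕ) : Monotone fun w : ℕ => a * (w + 1) ^ c :=
  fun _ _ h => Nat.mul_le_mul_left a (Nat.pow_le_pow_left (Nat.succ_le_succ h) c)

/-- **Uniform `D` transports through the closure**: if `\underline{L_e}(g) ≤ a (L_ws(g)+1)^c` for
all `g`, then `\underline{L_e}(f) ≤ a (\underline{L_ws}(f)+1)^c` for all `f` (`approxOf_le_of_uniform`).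
[cite: BurgisserEtAl2011, §9.3] -/
theorem approxFormula_le_of_uniformD {a c : ℕ}
    (hD : ∀ (τ : Type) [Fintype τ] [DecidableEq τ] (g : MvPolynomial τ ℂ),
      approxOf formulaComplexity g ≤ a * (wsComplexity g + 1) ^ c)
    {τ : Type} [Fintype τ] [DecidableEq τ] (f : MvPolynomial τ ℂ) :
    approxOf formulaComplexity f ≤ a * (approxWsComplexity f + 1) ^ c := by
  rw [← approxOf_wsComplexity]
  exact approxOf_le_of_uniform (μ := fun g => wsComplexity g) (monotone_mul_succ_pow a c) (hD τ) f

/-- **Under uniform `D`, `\overline{VP_ws} ⊆ \overline{VP_e}` on families.** [cite: BurgisserEtAl2011, §9.3] -/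
theorem vfBar_of_vpwsBar_of_uniformD {a c : ℕ}
    (hD : ∀ (τ : Type) [Fintype τ] [DecidableEq τ] (g : MvPolynomial τ ℂ),
      approxOf formulaComplexity g ≤ a * (wsComplexity g + 1) ^ c)
    {ι : ℕ → Type} [∀ n, Fintype (ι n)] [∀ n, DecidableEq (ι n)] {f : ∀ n, MvPolynomial (ι n) ℂ}
    (hf : IsVPwsBarFamily f) : IsPBounded fun n => approxOf formulaComplexity (f n) := by
  have hs : IsPBounded fun w : ℕ => a * (w + 1) ^ c :=
    (IsPBounded.iff_exists_le_mul_succ_pow _).2 ⟨a, c, fun _ => le_rfl⟩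
  exact (IsPBounded.comp_holds hs hf).mono fun n => approxFormula_le_of_uniformD hD (f n)

/-- Arithmetic of the det-universality bound: `m ≤ 3 (b w) + 1` and the det bound `m ^ e + e`
give `≤ ((3 b + 1) ^ e + e) (w + 1) ^ e`. [folklore] -/
theorem detBound_le {m b w e : ℕ} (hm : m ≤ 3 * (b * w) + 1) :
    m ^ e + e ≤ ((3 * b + 1) ^ e + e) * (w + 1) ^ e := by
  have h1 : m ≤ (3 * b + 1) * (w + 1) := by
    have : 3 * (b * w) + 1 ≤ (3 * b + 1) * (w + 1) := by nlinarith [Nat.zero_le b, Nat.zero_le w]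
    exact hm.trans this
  have h2 : m ^ e ≤ (3 * b + 1) ^ e * (w + 1) ^ e := by
    rw [← mul_pow]; exact Nat.pow_le_pow_left h1 e
  have h3 : e ≤ e * (w + 1) ^ e := Nat.le_mul_of_pos_right e (pow_pos (Nat.succ_pos w) e)
  calc m ^ e + e ≤ (3 * b + 1) ^ e * (w + 1) ^ e + e * (w + 1) ^ e := Nat.add_le_add h2 h3
    _ = ((3 * b + 1) ^ e + e) * (w + 1) ^ e := by ring

/-- **`(det_n) ∈ \overline{VP_e}` gives the uniform translation** `\underline{L_e}(g) ≤ a (L_ws(g)+1)^c`: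
every `g` is a projection of `det_{3 L_skew(g) + 1}` (Toda / Malod–Portier, the tree's
`HI16Skew.isProjection_detPoly_of_isSkew`) with `L_skew ≤ c₃ L_ws` (BLMW 2011 §9.4, [koka:08],
`BLMW2011_sec9_detVPws_holds` (iii)), and projections do not increase `\underline{L_e}`.
[cite: BurgisserEtAl2011, §9.2 (universality of det), §9.4; MalodPortier2008, Lemma 6] -/
theorem uniformD_of_detD (hdet : IsPBounded fun n => approxOf formulaComplexity (detPoly (Fin n) ℂ)) :
    ∃ a c : ℕ, ∀ (τ : Type) [Fintype τ] [DecidableEq τ] (g : MvPolynomial τ ℂ),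
      approxOf formulaComplexity g ≤ a * (wsComplexity g + 1) ^ c := by
  classical
  obtain ⟨c₃, hc₃⟩ := BLMW2011_sec9_detVPws_holds.2.2
  obtain ⟨e, he⟩ := hdet
  refine ⟨(3 * c₃ + 1) ^ e + e, e, fun τ _ _ g => ?_⟩
  obtain ⟨P, _, h2, hsk, hcomp, hsz⟩ := HI16Skew.skewComplexity_attained g
  rw [ArithCircuit.Computes] at hcomp
  have hproj : IsProjection g (detPoly (Fin (3 * P.size + 1)) ℂ) := by
    rw [← hcomp]; exact HI16Skew.isProjection_detPoly_of_isSkew P h2 hsk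
  have hm : 3 * P.size + 1 ≤ 3 * (c₃ * wsComplexity g) + 1 := by
    have := hc₃ g; rw [← hsz] at this; omega
  calc approxOf formulaComplexity g
      ≤ approxOf formulaComplexity (detPoly (Fin (3 * P.size + 1)) ℂ) :=
        approxFormula_le_of_isProjection hproj
    _ ≤ (3 * P.size + 1) ^ e + e := he _
    _ ≤ ((3 * c₃ + 1) ^ e + e) * (wsComplexity g + 1) ^ e := detBound_le hm

/-- **The uniform translation gives `(det_n) ∈ \overline{VP_e}`** (`(det_n) ∈ VP_ws`, BLMW 2011
§9.1 (i), the tree's `HI16Skew.isVPwsFamily_detPoly`). [cite: BurgisserEtAl2011, §9.1 (i)] -/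
theorem detD_of_uniformD {a c : ℕ}
    (hD : ∀ (τ : Type) [Fintype τ] [DecidableEq τ] (g : MvPolynomial τ ℂ),
      approxOf formulaComplexity g ≤ a * (wsComplexity g + 1) ^ c) :
    IsPBounded fun n => approxOf formulaComplexity (detPoly (Fin n) ℂ) :=
  vfBar_of_vpwsBar_of_uniformD hD (HI16Skew.isVPwsFamily_detPoly ℂ).isVPwsBarFamily

/-- **`D`, single-family form ⟺ uniform form.** [cite: BurgisserEtAl2011, §9.2, §9.4] -/
theorem detD_iff_uniformD :
    (IsPBounded fun n => approxOf formulaComplexity (detPoly (Fin n) ℂ)) ↔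
      ∃ a c : ℕ, ∀ (τ : Type) [Fintype τ] [DecidableEq τ] (g : MvPolynomial τ ℂ),
        approxOf formulaComplexity g ≤ a * (wsComplexity g + 1) ^ c :=
  ⟨uniformD_of_detD, fun ⟨_, _, h⟩ => detD_of_uniformD h⟩

/-- **`D`, class form `VP_ws ⊆ \overline{VP_e}` ⟺ single-family form `(det_n) ∈ \overline{VP_e}`.**
[cite: BurgisserEtAl2011, §9.1 (i), §9.2] -/
theorem familyD_iff_detD :
    (∀ {ι : ℕ → Type} [∀ n, Fintype (ι n)] [∀ n, DecidableEq (ι n)] (f : ∀ n, MvPolynomial (ι n) ℂ),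
        IsVPwsFamily f → IsPBounded fun n => approxOf formulaComplexity (f n)) ↔
      IsPBounded fun n => approxOf formulaComplexity (detPoly (Fin n) ℂ) := by
  refine ⟨fun h => h _ (HI16Skew.isVPwsFamily_detPoly ℂ), fun hdet => ?_⟩
  obtain ⟨a, c, hD⟩ := uniformD_of_detD hdet
  intro ι _ _ f hf
  exact vfBar_of_vpwsBar_of_uniformD hD hf.isVPwsBarFamily

/-- **Under `D` the two border classes coincide on every family**: `\overline{VP_e} = \overline{VP_ws}`
family-wise (so e.g. the census rungs `\overline{VF} ∩ 𝒫 ⊆ VNP` and `\overline{VBP} ∩ 𝒫 ⊆ VNP`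
merge under `D`). [cite: BurgisserEtAl2011, §9.3] -/
theorem vfBar_iff_vpwsBar (hdet : IsPBounded fun n => approxOf formulaComplexity (detPoly (Fin n) ℂ))
    {ι : ℕ → Type} [∀ n, Fintype (ι n)] [∀ n, DecidableEq (ι n)] (f : ∀ n, MvPolynomial (ι n) ℂ) :
    (IsPBounded fun n => approxOf formulaComplexity (f n)) ↔ IsVPwsBarFamily f := by
  obtain ⟨a, c, hD⟩ := uniformD_of_detD hdet
  exact ⟨fun h => h.mono fun n => approxWsComplexity_le_approxFormula (f n),
    vfBar_of_vpwsBar_of_uniformD hD⟩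

end PieceD

/-! ## §4 The notch identities and the deciding implication -/

section Notch

/-- **`A → H`**: `(per_n) ∉ \overline{VP_ws}` gives `(per_n) ∉ \overline{VP_e}`
(`\overline{VP_e} ⊆ \overline{VP_ws}`). [cite: BurgisserEtAl2011, §9.1, §9.3] -/
theorem perNotInVFBar_of_perNotInVPwsBar (hA : PerNotInVPwsBar) :
    ¬ IsPBounded fun n => approxOf formulaComplexity (perPoly (Fin n) ℂ) :=
  fun h => hA (h.mono fun n => approxWsComplexity_le_approxFormula (perPoly (Fin n) ℂ))

/-- **`H → D → A`**: if the permanent has superpolynomial border formula complexity and the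
determinant polynomial border formula complexity, then `(per_n) ∉ \overline{VP_ws}`
(= BLMW's form of the Mulmuley–Sohoni conjecture, Prop. 9.3.2).
[cite: BurgisserEtAl2011, Prop. 9.3.2, §9.3] -/
theorem perNotInVPwsBar_of_formulaNotch
    (hH : ¬ IsPBounded fun n => approxOf formulaComplexity (perPoly (Fin n) ℂ))
    (hD : IsPBounded fun n => approxOf formulaComplexity (detPoly (Fin n) ℂ)) : PerNotInVPwsBar :=
  fun hper => hH ((vfBar_iff_vpwsBar hD _).2 hper)

/-- **The residual at the VF notch is sandwiched**: `A → H` and `H ∧ D → A`, so under `D` the two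
residuals are equivalent. [cite: BurgisserEtAl2011, §9.3] -/
theorem perNotInVFBar_iff_perNotInVPwsBar
    (hD : IsPBounded fun n => approxOf formulaComplexity (detPoly (Fin n) ℂ)) :
    (¬ IsPBounded fun n => approxOf formulaComplexity (perPoly (Fin n) ℂ)) ↔ PerNotInVPwsBar :=
  ⟨fun hH => perNotInVPwsBar_of_formulaNotch hH hD, perNotInVFBar_of_perNotInVPwsBar⟩

/-- **Deciding implication at the VF notch**: `H → D → B → VP ≠ VNP`, through the lineage kernel
`valiant_of_sandwich : A → B → VP ≠ VNP`. [cite: BurgisserEtAl2011, Prop. 9.3.2; Valiant1979] -/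
theorem valiant_of_formulaNotch
    (hH : ¬ IsPBounded fun n => approxOf formulaComplexity (perPoly (Fin n) ℂ))
    (hD : IsPBounded fun n => approxOf formulaComplexity (detPoly (Fin n) ℂ))
    (hB : VPSubsetVPwsBar) : _root_.ValiantsHypothesis :=
  valiant_of_sandwich (perNotInVPwsBar_of_formulaNotch hH hD) hB

/-- **`T' → B`**: `VP ⊆ \overline{VP_e}` gives `VP ⊆ \overline{VP_ws}`. [cite: BurgisserEtAl2011, §9.3] -/
theorem vpSubsetVPwsBar_of_vpSubsetVFBar
    (hT : ∀ {ι : ℕ → Type} [∀ n, Fintype (ι n)] [∀ n, DecidableEq (ι n)]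
      (f : ∀ n, MvPolynomial (ι n) ℂ), IsVPFamily f →
        IsPBounded fun n => approxOf formulaComplexity (f n)) :
    VPSubsetVPwsBar := by
  intro ι _ _ f hf
  exact (hT f hf).mono fun n => approxWsComplexity_le_approxFormula (f n)

/-- **`T' → D`**: `(det_n)` is a `VP` family (`VP_ws ⊆ VP` in `n²` variables).
[cite: BurgisserEtAl2011, §9.1 (i), (VP_ws ⊆ VP)] -/
theorem detD_of_vpSubsetVFBar
    (hT : ∀ {ι : ℕ → Type} [∀ n, Fintype (ι n)] [∀ n, DecidableEq (ι n)]
      (f : ∀ n, MvPolynomial (ι n) ℂ), IsVPFamily f →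
        IsPBounded fun n => approxOf formulaComplexity (f n)) :
    IsPBounded fun n => approxOf formulaComplexity (detPoly (Fin n) ℂ) := by
  refine hT _ ((HI16Skew.isVPwsFamily_detPoly ℂ).isVPFamily ?_)
  simpa [Fintype.card_prod, Fintype.card_fin, ← pow_two] using
    (IsPBounded.pow_holds IsPBounded.id 2 : IsPBounded fun n : ℕ => n ^ 2)

/-- **`T' ⟺ B ∧ D`**: `VP ⊆ \overline{VP_e}` iff `VP ⊆ \overline{VP_ws}` and
`(det_n) ∈ \overline{VP_e}`. [cite: BurgisserEtAl2011, §9.1–§9.3] -/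
theorem vpSubsetVFBar_iff :
    (∀ {ι : ℕ → Type} [∀ n, Fintype (ι n)] [∀ n, DecidableEq (ι n)]
      (f : ∀ n, MvPolynomial (ι n) ℂ), IsVPFamily f →
        IsPBounded fun n => approxOf formulaComplexity (f n)) ↔
      VPSubsetVPwsBar ∧ IsPBounded fun n => approxOf formulaComplexity (detPoly (Fin n) ℂ) := by
  constructor
  · exact fun hT => ⟨vpSubsetVPwsBar_of_vpSubsetVFBar hT, detD_of_vpSubsetVFBar hT⟩
  · rintro ⟨hB, hD⟩
    intro ι i1 i2 f hf
    have h1 : IsVPwsBarFamily f := hB f hf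
    exact (vfBar_iff_vpwsBar hD f).2 h1

end Notch

end Summit.ValiantsHypothesis.ValiantsHypothesis.Theorems.BorderFormulaNotch
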